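import Mathlib.Analysis.SpecialFunctions.Log.Base
import Literature.Computability.AlgebraicComplexity.MatrixMultiplicationExponent
import HarnessLib

/-!
# Named facts on the rank of the matrix multiplication tensor (Bläser 2013, §5)

Topic: `Literature/Computability/AlgebraicComplexity`. Published, elementary facts about
`R(⟨n, n, n⟩) = tensorRank (matMulTensor K n n n)` and `ω(K) = omega K`
(`MatrixMultiplicationExponent.lean`), vendored as `def … : Prop` (users take `(h : FactName)`),
for the routes towards `MatrixMultiplication` (`ω(ℂ) = 2`). No Kronecker product of coordinate
tensors is defined here: the two facts that use it in print are vendored in the form specialised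
to matrix multiplication tensors, where `⟨k,m,n⟩ ⊗ ⟨k',m',n'⟩ ≅ ⟨kk',mm',nn'⟩` (Bläser 2013, p. 24)
turns them into statements about `matMulTensor` alone.

## Content

* `Blaser2013RankSubmult` — `R(⟨nm, nm, nm⟩) ≤ R(⟨n, n, n⟩) · R(⟨m, m, m⟩)` over any field
  (Bläser 2013, Lemma 5.8 `R(t ⊗ t') ≤ R(t) R(t')` with the identity
  `⟨k,m,n⟩ ⊗ ⟨k',m',n'⟩ = ⟨kk',mm',nn'⟩`, p. 24, and invariance of rank under isomorphism,
  Lemma 5.4).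
* `Blaser2013RankMonotone` — `n ≤ m → R(⟨n, n, n⟩) ≤ R(⟨m, m, m⟩)` (Bläser 2013, Lemma 5.4
  `R((A ⊗ B ⊗ C) t) ≤ R(t)` applied to the coordinate projections / Def. 7.2: `⟨n,n,n⟩` is a
  restriction of `⟨m,m,m⟩`).
* `Blaser2013Thm59` — if `R(⟨k, m, n⟩) ≤ r` then `ω ≤ 3 · log_{kmn} r` (Bläser 2013, Thm. 5.9),
  for `kmn > 1`.

## Sources

* M. Bläser, *Fast Matrix Multiplication*, Theory of Computing Library, Graduate Surveys 5 (2013),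
  Lemma 5.4, Lemma 5.5, Lemma 5.8, p. 24 (tensor product of matrix tensors), Thm. 5.9, Def. 7.2.
* P. Bürgisser, M. Clausen, M. A. Shokrollahi, *Algebraic Complexity Theory* (1997), Ch. 14–15
  (same statements; Prop. 14.23, (14.19)).

## Design choices

* Stated over a `Field K` in `Type` (the items of the routes quantify this way; Bläser works over
  a field throughout §5).
* `Blaser2013Thm59` carries the side condition `1 < k * m * n` (the printed statement is vacuous /
  ill-posed for `kmn = 1`) and uses `Real.logb`. Since `omega K` is an `sInf` over `ℝ`, the
  printed proof (which exhibits admissible exponents `> 3 log_{kmn} r`) gives the inequality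
  whether or not the exponent set is bounded below (if unbounded, `sInf = 0 ≤ 3 log_{kmn} r` for
  `r ≥ 1`, and `r = 0` forces `kmn = 0`).
-/

noncomputable section

namespace Literature.Computability.AlgebraicComplexity

/-- NAMED FACT — **submultiplicativity of matrix multiplication rank** (Bläser 2013, Lemma 5.8
with the identity `⟨n,n,n⟩ ⊗ ⟨m,m,m⟩ = ⟨nm,nm,nm⟩`, p. 24, and Lemma 5.4): over any field,
`R(⟨nm, nm, nm⟩) ≤ R(⟨n, n, n⟩) · R(⟨m, m, m⟩)`. Users take `(h : Blaser2013RankSubmult)`.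
[cite: Blaser2013, Lemma 5.8] -/
def Blaser2013RankSubmult : Prop :=
  ∀ (K : Type) [Field K] (n m : ℕ),
    tensorRank (matMulTensor K (n * m) (n * m) (n * m)) ≤
      tensorRank (matMulTensor K n n n) * tensorRank (matMulTensor K m m m)

/-- NAMED FACT — **monotonicity of matrix multiplication rank in the format** (Bläser 2013,
Lemma 5.4: `R((A ⊗ B ⊗ C) t) ≤ R(t)`, applied to the coordinate projections
`K^{m×m} → K^{n×n}`, i.e. `⟨n,n,n⟩ ≤ ⟨m,m,m⟩` is a restriction, Def. 7.2): for `n ≤ m`,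
`R(⟨n, n, n⟩) ≤ R(⟨m, m, m⟩)`. Users take `(h : Blaser2013RankMonotone)`.
[cite: Blaser2013, Lemma 5.4] -/
def Blaser2013RankMonotone : Prop :=
  ∀ (K : Type) [Field K] (n m : ℕ), n ≤ m →
    tensorRank (matMulTensor K n n n) ≤ tensorRank (matMulTensor K m m m)

/-- NAMED FACT — **Bläser 2013, Thm. 5.9** ("If `R(⟨k, m, n⟩) ≤ r`, then `ω ≤ 3 · log_{kmn} r`";
proof: symmetrise with Lemma 5.5, tensor with Lemma 5.8 to `R(⟨N,N,N⟩) ≤ r³`, `N = kmn`, then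
`R(⟨Nˢ,Nˢ,Nˢ⟩) ≤ r^{3s}` and interpolate). Stated for `kmn > 1`.
Users take `(h : Blaser2013Thm59)`. [cite: Blaser2013, Thm. 5.9] -/
def Blaser2013Thm59 : Prop :=
  ∀ (K : Type) [Field K] (k m n r : ℕ), 1 < k * m * n →
    tensorRank (matMulTensor K k m n) ≤ r →
      omega K ≤ 3 * Real.logb (k * m * n : ℕ) r

/-! ## API -/

/-- Under Bläser's Thm. 5.9, Strassen's `R(⟨2,2,2⟩) ≤ 7` gives `ω ≤ 3 log_8 7 = log_2 7`; here
only the shape: any rank bound `R(⟨n,n,n⟩) ≤ r` with `n ≥ 2` bounds `ω(K)` by `3 log_{n³} r`.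
[cite: Blaser2013, Thm. 5.9] -/
theorem omega_le_of_rank_le (h : Blaser2013Thm59) (K : Type) [Field K] {n r : ℕ} (hn : 2 ≤ n)
    (hr : tensorRank (matMulTensor K n n n) ≤ r) :
    omega K ≤ 3 * Real.logb (n * n * n : ℕ) r := by
  refine h K n n n r ?_ hr
  have h1 : 1 < n := hn
  calc 1 < n := h1
    _ ≤ n * n * n := by
      have : 1 ≤ n * n := Nat.one_le_iff_ne_zero.mpr (by positivity)
      nlinarith

end Literature.Computability.AlgebraicComplexity

end
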